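import Mathlib
import Summits.QuantumFields.YangMills.Theses.TransportFieldFano
import Summits.QuantumFields.YangMills.Theorems.TransportFieldPolyakovLineDerivative
import Summits.QuantumFields.YangMills.Theorems.TransportFieldFanoTransportKineticCeilingStubLinearSplit
import Summits.QuantumFields.YangMills.Theorems.TransportFieldFlowInvariance
import Summits.QuantumFields.YangMills.Theorems.AdjointLoopFanoDirichletKinematic
import HarnessLib

/-!
# Item `TransportFieldFano.RobertsonInequality` ⟨stmt-QuantumFields-23355⟩ — CLOSED: the Robertson / Cramér–Rao inequality for the transport field

`robertsonInequality_proof : Summit.QuantumFields.YangMills.Theses.TransportFieldFano.RobertsonInequality`: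
for `β > 0`, `L ≥ 2` and every normalised physical vacuum `Ω`, `⟨(XF)Ω, Ω⟩² ≤ 4‖XΩ‖²(‖FΩ‖² − ⟨FΩ,Ω⟩²)`.
Route (regularity kit, tranches 1–5): per base site `x` the direction `b(W_x(U))` is continuous and BLIND to the link `(x,0)` (`W_x` is built from
the direction-`1` link at `x+ê₀` and the direction-`0` Polyakov line through `x+ê₀+ê₁`, which misses `(x,0)` when `L ≥ 2`); along the resulting
flow both `F` (tranche 5) and `Ω` (tranches 1–3b) are differentiable with continuous derivatives and Lipschitz; the right-Haar identity
`∫ ∂_t|₀ G(U_t) dU = 0` (✓ `integral_deriv_flow_eq_zero`) for `G = (F − c)Ω²`, `c = ⟨FΩ,Ω⟩`, gives `∫ (∂_xF)Ω² = −2∫(F−c)Ω ∂_xΩ`; summing over `x`,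
`⟨(XF)Ω,Ω⟩ = −2⟨(F−c)Ω, XΩ⟩`, and Cauchy–Schwarz with `‖(F−c)Ω‖² = ‖FΩ‖² − c²` (`‖Ω‖ = 1`) finishes.
HONEST FRAMING: a support item of LINE g17-A; the cruxes, K2a and the YM mass gap are NOT proved.  No `sorry`, no new axiom, no new definition.
References: [cite: ReedSimonIV1978, Thm. XIII.43]; [cite: Balaban1985UV3, p. 260]; [cite: Creutz2022, Ch. 11].
-/

set_option autoImplicit false

noncomputable section

open MeasureTheory Filter Topology
open scoped BigOperators
open Literature.MathematicalPhysics.QuantumFieldTheory (GaugeConfig Site Edge lineHolonomy)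
open Literature.MathematicalPhysics.QuantumLattice (secondCountableTopology_su2)
open Literature.MathematicalPhysics.QuantumFieldTheory.Balaban1983to89.B10Eq18SigmaSU2 (pauli)
open Literature.MathematicalPhysics.QuantumFieldTheory.Balaban1983to89.B10Eq18SigmaSU2Haar (expPauli expPauli_zero)
open Summit.QuantumFields.YangMills.Theorems.EquipartitionPinsProbe.TangentSteinFiniteBeta (lipschitz_of_flow exists_abs_le_of_continuous)

namespace Summit.QuantumFields.YangMills.Theorems.TransportFieldFano

open Summit.QuantumFields.YangMills.Theorems.FemtoTransferGap
open Summit.QuantumFields.YangMills.Theorems.TransportField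
open Summit.QuantumFields.YangMills.Theorems.AdjointLoopFano (isPhys_adjLoop)

variable {L : ℕ} [NeZero L]

/-! ## §1 The window direction is blind to the shifted link (`L ≥ 2`) -/

omit [NeZero L] in
/-- For `L ≥ 2` the window holonomy `W_x(U)` does not see the link `(x, 0)`. [folklore] -/
theorem windowHolonomy_update (hL : 2 ≤ L) (U : GaugeConfig 3 L SU2) (x : Site 3 L) (y : SU2) :
    ((Function.update U (x, (0 : Fin 3)) y) ((x).shift 0, (1 : Fin 3)) * polyakovSite (((x).shift 0).shift 1) (Function.update U (x, (0 : Fin 3)) y) ((0 : Site 3 1), (0 : Fin 3)) * ((Function.update U (x, (0 : Fin 3)) y) ((x).shift 0, (1 : Fin 3)))⁻¹) = (U ((x).shift 0, (1 : Fin 3)) * polyakovSite (((x).shift 0).shift 1) U ((0 : Site 3 1), (0 : Fin 3)) * (U ((x).shift 0, (1 : Fin 3)))⁻¹) := by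
  have hne : (x.shift 0, (1 : Fin 3)) ≠ (x, (0 : Fin 3)) := fun h => by
    have h2 : (1 : Fin 3) = 0 := congrArg Prod.snd h
    exact absurd h2 (by decide)
  haveI : Fact (1 < L) := ⟨hL⟩
  have hoff : ((x.shift 0).shift 1) (1 : Fin 3) ≠ x 1 := by
    simp only [Site.shift, Pi.add_apply, Pi.single_apply, if_true]
    rw [if_neg (by decide : (1 : Fin 3) ≠ 0)]
    intro h
    have : (1 : ZMod L) = 0 := by
      have h' := congrArg (fun z => z - x 1) h
      simp at h'
    exact one_ne_zero this
  rw [Function.update_of_ne hne]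
  show _ * lineHolonomy (Function.update U (x, (0 : Fin 3)) y) 0 L ((x.shift 0).shift 1) * _ = _ * lineHolonomy U 0 L ((x.shift 0).shift 1) * _
  rw [lineHolonomy_update_offline U x y (by decide : (1 : Fin 3) ≠ 0) L _ hoff]

/-! ## §2 Cauchy–Schwarz and product integrability for bounded measurable functions -/

/-- Integrability of a product of two bounded measurable functions on the compact configuration space. [folklore] -/
theorem integrable_mul_of_bdd {f g : GaugeConfig 3 L SU2 → ℝ} (hf : Measurable f) (hg : Measurable g) {Cf Cg : ℝ}
    (hCf : ∀ U, |f U| ≤ Cf) (hCg : ∀ U, |g U| ≤ Cg) : Integrable (fun U => f U * g U) (configMeasure SU2 L) := by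
  haveI : IsProbabilityMeasure (configMeasure SU2 L) := by unfold configMeasure; infer_instance
  refine Integrable.of_bound (hf.mul hg).aestronglyMeasurable (Cf * Cg) (ae_of_all _ fun U => ?_)
  rw [Real.norm_eq_abs, abs_mul]
  exact mul_le_mul (hCf U) (hCg U) (abs_nonneg _) ((abs_nonneg _).trans (hCf U))

/-- **Cauchy–Schwarz, squared form**: `⟨f,g⟩² ≤ ⟨f,f⟩⟨g,g⟩` for bounded measurable `f, g`. [folklore] -/
theorem l2_sq_le_of_bdd {f g : GaugeConfig 3 L SU2 → ℝ} (hf : Measurable f) (hg : Measurable g) {Cf Cg : ℝ}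
    (hCf : ∀ U, |f U| ≤ Cf) (hCg : ∀ U, |g U| ≤ Cg) : l2 f g ^ 2 ≤ l2 f f * l2 g g := by
  have hff := integrable_mul_of_bdd hf hf hCf hCf
  have hgg := integrable_mul_of_bdd hg hg hCg hCg
  have hfg := integrable_mul_of_bdd hf hg hCf hCg
  have hquad : ∀ t : ℝ, 0 ≤ l2 g g * (t * t) + (-(2 * l2 f g)) * t + l2 f f := by
    intro t
    have h0 : 0 ≤ ∫ U, (f U - t * g U) * (f U - t * g U) ∂configMeasure SU2 L := integral_nonneg fun U => mul_self_nonneg _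
    have hpt : (fun U => (f U - t * g U) * (f U - t * g U)) = fun U => t * t * (g U * g U) + -(2 * t) * (f U * g U) + f U * f U := by
      funext U; ring
    have i1 : Integrable (fun U => t * t * (g U * g U)) (configMeasure SU2 L) := hgg.const_mul _
    have i2 : Integrable (fun U => -(2 * t) * (f U * g U)) (configMeasure SU2 L) := hfg.const_mul _
    have i12 : Integrable (fun U => t * t * (g U * g U) + -(2 * t) * (f U * g U)) (configMeasure SU2 L) := i1.add i2
    rw [hpt, integral_add i12 hff, integral_add i1 i2, integral_const_mul, integral_const_mul] at h0
    unfold l2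
    linarith
  have hdisc := discrim_le_zero hquad
  rw [discrim] at hdisc
  nlinarith

/-! ## §3 One base site: integration by parts against `Ω²` -/

/-- **Per-link integration by parts.**  For a continuous `e`-blind direction field `a`, a physical vacuum `Ω` and a constant `c`:
`∫ F'(U) Ω(U)² dU = −2 ∫ (F(U) − c) Ω(U) ∂Ω(U) dU`, where `F'` is the derivative field of `F` and `∂Ω` that of `Ω` along the flow.
[cite: ReedSimonIV1978, Thm. XIII.43] [cite: Creutz2022, Ch. 11] -/
theorem integral_torelonDeriv_vacuum_sq (β : ℝ) (e : Edge 3 L) {a : GaugeConfig 3 L SU2 → EuclideanSpace ℝ (Fin 3)}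
    (ha : Continuous a) (hblind : ∀ (U : GaugeConfig 3 L SU2) (y : SU2), a (Function.update U e y) = a U)
    {Ω : GaugeConfig 3 L SU2 → ℝ} (hΩ : IsPhys Ω) (heig : transferApply β Ω = topValue su2Rep L β • Ω) (c : ℝ) :
    ∫ U, deriv (fun t : ℝ => (flowLift 0 (fun u : GaugeConfig 3 1 SU2 => 4 - ((su2Rep (u ((0 : Site 3 1), (0 : Fin 3)))).trace.re) ^ 2)) (Function.update U e (U e * expPauli (t • a U)))) 0 * (Ω U * Ω U) ∂configMeasure SU2 L =
      -2 * ∫ U, ((flowLift 0 (fun u : GaugeConfig 3 1 SU2 => 4 - ((su2Rep (u ((0 : Site 3 1), (0 : Fin 3)))).trace.re) ^ 2)) U - c) * Ω U *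
        deriv (fun t : ℝ => Ω (Function.update U e (U e * expPauli (t • a U)))) 0 ∂configMeasure SU2 L := by
  haveI : SecondCountableTopology SU2 := secondCountableTopology_su2
  -- `F`: derivative field, Lipschitz constant
  obtain ⟨F', hF'c, ⟨CF', hCF'0, hCF', hFlip⟩, hF'⟩ := lipschitz_torelonDev_flow e ha hblind
  have hFphys : IsPhys (L := L) (flowLift 0 (fun u : GaugeConfig 3 1 SU2 => 4 - ((su2Rep (u ((0 : Site 3 1), (0 : Fin 3)))).trace.re) ^ 2)) := isPhys_adjLoop
  obtain ⟨CF, hCF⟩ := hFphys.bounded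
  have hCF0 : 0 ≤ CF := (abs_nonneg _).trans (hCF (fun _ : Edge 3 L => (1 : SU2)))
  -- `Ω`: derivative field, Lipschitz constant
  obtain ⟨CΩ, hCΩ⟩ := hΩ.bounded
  have hCΩ0 : 0 ≤ CΩ := (abs_nonneg _).trans (hCΩ (fun _ : Edge 3 L => (1 : SU2)))
  obtain ⟨CdΩ, hCdΩ0, hCdΩ⟩ := bounded_deriv_vacuum_rightShift β e ha hΩ heig
  set T : ℝ → GaugeConfig 3 L SU2 → GaugeConfig 3 L SU2 := fun t U => Function.update U e (U e * expPauli (t • a U)) with hT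
  have hflow : ∀ s t U, T (t + s) U = T t (T s U) := fun s t U => update_expPauli_flow e hblind s t U
  have hT0 : ∀ U, T 0 U = U := fun U => by simp only [hT, zero_smul, expPauli_zero, mul_one, Function.update_eq_self]
  have hdΩ : ∀ U, HasDerivAt (fun t => Ω (T t U)) (deriv (fun t : ℝ => Ω (Function.update U e (U e * expPauli (t • a U)))) 0) 0 :=
    fun U => (differentiableAt_vacuum_rightShift β e (a U) hΩ heig U).hasDerivAt
  have hΩlip : ∀ U t s, |Ω (T t U) - Ω (T s U)| ≤ CdΩ * |t - s| := fun U t s => lipschitz_of_flow T hflow Ω _ hdΩ hCdΩ U t s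
  -- the product `G = (F − c) Ω²`
  have hGm : Measurable fun U => ((flowLift 0 (fun u : GaugeConfig 3 1 SU2 => 4 - ((su2Rep (u ((0 : Site 3 1), (0 : Fin 3)))).trace.re) ^ 2)) U - c) * (Ω U * Ω U) :=
    (hFphys.measurable.sub measurable_const).mul (hΩ.measurable.mul hΩ.measurable)
  have hGb : ∀ U, |((flowLift 0 (fun u : GaugeConfig 3 1 SU2 => 4 - ((su2Rep (u ((0 : Site 3 1), (0 : Fin 3)))).trace.re) ^ 2)) U - c) * (Ω U * Ω U)| ≤ (CF + |c|) * (CΩ * CΩ) := by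
    intro U
    rw [abs_mul, abs_mul]
    exact mul_le_mul ((abs_sub _ _).trans (add_le_add (hCF U) le_rfl)) (mul_le_mul (hCΩ U) (hCΩ U) (abs_nonneg _) hCΩ0)
      (mul_nonneg (abs_nonneg _) (abs_nonneg _)) (by positivity)
  have hGlip : ∀ (t : ℝ) (U : GaugeConfig 3 L SU2),
      |((flowLift 0 (fun u : GaugeConfig 3 1 SU2 => 4 - ((su2Rep (u ((0 : Site 3 1), (0 : Fin 3)))).trace.re) ^ 2)) (Function.update U e (U e * expPauli (t • a U))) - c) *
          (Ω (Function.update U e (U e * expPauli (t • a U))) * Ω (Function.update U e (U e * expPauli (t • a U)))) -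
        ((flowLift 0 (fun u : GaugeConfig 3 1 SU2 => 4 - ((su2Rep (u ((0 : Site 3 1), (0 : Fin 3)))).trace.re) ^ 2)) U - c) * (Ω U * Ω U)| ≤ (CF' * (CΩ * CΩ) + (CF + |c|) * (2 * CΩ * CdΩ)) * |t| := by
    intro t U
    have hF1 := hFlip U t 0
    have hΩ1 := hΩlip U t 0
    rw [hT0 U, sub_zero] at hΩ1
    simp only [zero_smul, expPauli_zero, mul_one, Function.update_eq_self, sub_zero] at hF1
    show |((flowLift 0 (fun u : GaugeConfig 3 1 SU2 => 4 - ((su2Rep (u ((0 : Site 3 1), (0 : Fin 3)))).trace.re) ^ 2)) (T t U) - c) * (Ω (T t U) * Ω (T t U)) - ((flowLift 0 (fun u : GaugeConfig 3 1 SU2 => 4 - ((su2Rep (u ((0 : Site 3 1), (0 : Fin 3)))).trace.re) ^ 2)) U - c) * (Ω U * Ω U)| ≤ _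
    have hsplit : ((flowLift 0 (fun u : GaugeConfig 3 1 SU2 => 4 - ((su2Rep (u ((0 : Site 3 1), (0 : Fin 3)))).trace.re) ^ 2)) (T t U) - c) * (Ω (T t U) * Ω (T t U)) - ((flowLift 0 (fun u : GaugeConfig 3 1 SU2 => 4 - ((su2Rep (u ((0 : Site 3 1), (0 : Fin 3)))).trace.re) ^ 2)) U - c) * (Ω U * Ω U) =
        ((flowLift 0 (fun u : GaugeConfig 3 1 SU2 => 4 - ((su2Rep (u ((0 : Site 3 1), (0 : Fin 3)))).trace.re) ^ 2)) (T t U) - (flowLift 0 (fun u : GaugeConfig 3 1 SU2 => 4 - ((su2Rep (u ((0 : Site 3 1), (0 : Fin 3)))).trace.re) ^ 2)) U) * (Ω (T t U) * Ω (T t U)) +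
          ((flowLift 0 (fun u : GaugeConfig 3 1 SU2 => 4 - ((su2Rep (u ((0 : Site 3 1), (0 : Fin 3)))).trace.re) ^ 2)) U - c) * ((Ω (T t U) + Ω U) * (Ω (T t U) - Ω U)) := by ring
    rw [hsplit]
    refine (abs_add_le _ _).trans ?_
    rw [abs_mul, abs_mul, abs_mul, abs_mul, add_mul]
    refine add_le_add ?_ ?_
    · calc |(flowLift 0 (fun u : GaugeConfig 3 1 SU2 => 4 - ((su2Rep (u ((0 : Site 3 1), (0 : Fin 3)))).trace.re) ^ 2)) (T t U) - (flowLift 0 (fun u : GaugeConfig 3 1 SU2 => 4 - ((su2Rep (u ((0 : Site 3 1), (0 : Fin 3)))).trace.re) ^ 2)) U| * (|Ω (T t U)| * |Ω (T t U)|)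
          ≤ CF' * |t| * (CΩ * CΩ) := mul_le_mul hF1 (mul_le_mul (hCΩ _) (hCΩ _) (abs_nonneg _) hCΩ0)
              (mul_nonneg (abs_nonneg _) (abs_nonneg _)) (by positivity)
        _ = CF' * (CΩ * CΩ) * |t| := by ring
    · have h2 : |Ω (T t U) + Ω U| ≤ 2 * CΩ := (abs_add_le _ _).trans (by linarith [hCΩ (T t U), hCΩ U])
      calc |(flowLift 0 (fun u : GaugeConfig 3 1 SU2 => 4 - ((su2Rep (u ((0 : Site 3 1), (0 : Fin 3)))).trace.re) ^ 2)) U - c| * (|Ω (T t U) + Ω U| * |Ω (T t U) - Ω U|)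
          ≤ (CF + |c|) * (2 * CΩ * (CdΩ * |t|)) :=
            mul_le_mul ((abs_sub _ _).trans (add_le_add (hCF U) le_rfl)) (mul_le_mul h2 hΩ1 (abs_nonneg _) (by positivity))
              (mul_nonneg (abs_nonneg _) (abs_nonneg _)) (by positivity)
        _ = (CF + |c|) * (2 * CΩ * CdΩ) * |t| := by ring
  have hGd : ∀ U : GaugeConfig 3 L SU2, DifferentiableAt ℝ (fun t : ℝ =>
      ((flowLift 0 (fun u : GaugeConfig 3 1 SU2 => 4 - ((su2Rep (u ((0 : Site 3 1), (0 : Fin 3)))).trace.re) ^ 2)) (Function.update U e (U e * expPauli (t • a U))) - c) *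
        (Ω (Function.update U e (U e * expPauli (t • a U))) * Ω (Function.update U e (U e * expPauli (t • a U))))) 0 :=
    fun U => ((hF' U).differentiableAt.sub_const c).mul
      ((differentiableAt_vacuum_rightShift β e (a U) hΩ heig U).mul (differentiableAt_vacuum_rightShift β e (a U) hΩ heig U))
  have hzero := integral_deriv_flow_eq_zero e ha.measurable hblind hGm hGb hGlip hGd
  -- the derivative of `G` along the flow
  have hderiv : ∀ U : GaugeConfig 3 L SU2, deriv (fun t : ℝ =>
      ((flowLift 0 (fun u : GaugeConfig 3 1 SU2 => 4 - ((su2Rep (u ((0 : Site 3 1), (0 : Fin 3)))).trace.re) ^ 2)) (Function.update U e (U e * expPauli (t • a U))) - c) *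
        (Ω (Function.update U e (U e * expPauli (t • a U))) * Ω (Function.update U e (U e * expPauli (t • a U))))) 0 =
      deriv (fun t : ℝ => (flowLift 0 (fun u : GaugeConfig 3 1 SU2 => 4 - ((su2Rep (u ((0 : Site 3 1), (0 : Fin 3)))).trace.re) ^ 2)) (Function.update U e (U e * expPauli (t • a U)))) 0 * (Ω U * Ω U) +
        2 * (((flowLift 0 (fun u : GaugeConfig 3 1 SU2 => 4 - ((su2Rep (u ((0 : Site 3 1), (0 : Fin 3)))).trace.re) ^ 2)) U - c) * Ω U * deriv (fun t : ℝ => Ω (Function.update U e (U e * expPauli (t • a U)))) 0) := by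
    intro U
    have h := ((hF' U).sub_const c).fun_mul ((hdΩ U).fun_mul (hdΩ U))
    simp only [hT, zero_smul, expPauli_zero, mul_one, Function.update_eq_self] at h
    rw [h.deriv, (hF' U).deriv]; ring
  -- integrability of the two pieces
  have hdFm : Measurable fun U => deriv (fun t : ℝ => (flowLift 0 (fun u : GaugeConfig 3 1 SU2 => 4 - ((su2Rep (u ((0 : Site 3 1), (0 : Fin 3)))).trace.re) ^ 2)) (Function.update U e (U e * expPauli (t • a U)))) 0 := by
    have : (fun U => deriv (fun t : ℝ => (flowLift 0 (fun u : GaugeConfig 3 1 SU2 => 4 - ((su2Rep (u ((0 : Site 3 1), (0 : Fin 3)))).trace.re) ^ 2)) (Function.update U e (U e * expPauli (t • a U)))) 0) = F' :=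
      funext fun U => (hF' U).deriv
    rw [this]; exact hF'c.measurable
  have hdFb : ∀ U, |deriv (fun t : ℝ => (flowLift 0 (fun u : GaugeConfig 3 1 SU2 => 4 - ((su2Rep (u ((0 : Site 3 1), (0 : Fin 3)))).trace.re) ^ 2)) (Function.update U e (U e * expPauli (t • a U)))) 0| ≤ CF' :=
    fun U => by rw [(hF' U).deriv]; exact hCF' U
  have hi1 : Integrable (fun U => deriv (fun t : ℝ => (flowLift 0 (fun u : GaugeConfig 3 1 SU2 => 4 - ((su2Rep (u ((0 : Site 3 1), (0 : Fin 3)))).trace.re) ^ 2)) (Function.update U e (U e * expPauli (t • a U)))) 0 * (Ω U * Ω U))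
      (configMeasure SU2 L) :=
    integrable_mul_of_bdd hdFm (hΩ.measurable.mul hΩ.measurable) hdFb
      (fun U => by rw [abs_mul]; exact mul_le_mul (hCΩ U) (hCΩ U) (abs_nonneg _) hCΩ0)
  have hi2 : Integrable (fun U => ((flowLift 0 (fun u : GaugeConfig 3 1 SU2 => 4 - ((su2Rep (u ((0 : Site 3 1), (0 : Fin 3)))).trace.re) ^ 2)) U - c) * Ω U *
      deriv (fun t : ℝ => Ω (Function.update U e (U e * expPauli (t • a U)))) 0) (configMeasure SU2 L) :=
    integrable_mul_of_bdd ((hFphys.measurable.sub measurable_const).mul hΩ.measurable)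
      (measurable_deriv_vacuum_rightShift β e ha hΩ heig)
      (fun U => by rw [abs_mul]; exact mul_le_mul ((abs_sub _ _).trans (add_le_add (hCF U) le_rfl)) (hCΩ U) (abs_nonneg _) (add_nonneg hCF0 (abs_nonneg c)))
      hCdΩ
  simp only [hderiv] at hzero
  rw [integral_add hi1 (hi2.const_mul 2), integral_const_mul] at hzero
  linarith

/-! ## §4 The item -/

/-- ★★★ **`TransportFieldFano.RobertsonInequality`** ⟨stmt-QuantumFields-23355⟩. [cite: ReedSimonIV1978, Thm. XIII.43] [cite: Balaban1985UV3, p. 260] -/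
theorem robertsonInequality_proof : Summit.QuantumFields.YangMills.Theses.TransportFieldFano.RobertsonInequality := by
  intro β _hβ L _ hL Ω hΩ hn heig
  dsimp only
  haveI : SecondCountableTopology SU2 := secondCountableTopology_su2
  -- direction fields: continuous and blind
  have hdir : ∀ x : Site 3 L, Continuous fun U : GaugeConfig 3 L SU2 => ((EuclideanSpace.equiv (Fin 3) ℝ).symm fun i => (su2Rep (U ((x).shift 0, (1 : Fin 3)) * polyakovSite (((x).shift 0).shift 1) U ((0 : Site 3 1), (0 : Fin 3)) * (U ((x).shift 0, (1 : Fin 3)))⁻¹)).trace.re * (-(Complex.I / 2) * (pauli i * su2Rep (U ((x).shift 0, (1 : Fin 3)) * polyakovSite (((x).shift 0).shift 1) U ((0 : Site 3 1), (0 : Fin 3)) * (U ((x).shift 0, (1 : Fin 3)))⁻¹)).trace).re) :=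
    fun x => continuous_colourVec.comp (continuous_windowHolonomy x)
  have hblind : ∀ (x : Site 3 L) (U : GaugeConfig 3 L SU2) (y : SU2),
      ((EuclideanSpace.equiv (Fin 3) ℝ).symm fun i => (su2Rep ((Function.update U (x, (0 : Fin 3)) y) ((x).shift 0, (1 : Fin 3)) * polyakovSite (((x).shift 0).shift 1) (Function.update U (x, (0 : Fin 3)) y) ((0 : Site 3 1), (0 : Fin 3)) * ((Function.update U (x, (0 : Fin 3)) y) ((x).shift 0, (1 : Fin 3)))⁻¹)).trace.re * (-(Complex.I / 2) * (pauli i * su2Rep ((Function.update U (x, (0 : Fin 3)) y) ((x).shift 0, (1 : Fin 3)) * polyakovSite (((x).shift 0).shift 1) (Function.update U (x, (0 : Fin 3)) y) ((0 : Site 3 1), (0 : Fin 3)) * ((Function.update U (x, (0 : Fin 3)) y) ((x).shift 0, (1 : Fin 3)))⁻¹)).trace).re) = ((EuclideanSpace.equiv (Fin 3) ℝ).symm fun i => (su2Rep (U ((x).shift 0, (1 : Fin 3)) * polyakovSite (((x).shift 0).shift 1) U ((0 : Site 3 1), (0 : Fin 3)) * (U ((x).shift 0, (1 : Fin 3)))⁻¹)).trace.re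 * (-(Complex.I / 2) * (pauli i * su2Rep (U ((x).shift 0, (1 : Fin 3)) * polyakovSite (((x).shift 0).shift 1) U ((0 : Site 3 1), (0 : Fin 3)) * (U ((x).shift 0, (1 : Fin 3)))⁻¹)).trace).re) := by
    intro x U y; rw [windowHolonomy_update hL]
  set c : ℝ := l2 (fun U => (flowLift 0 (fun u : GaugeConfig 3 1 SU2 => 4 - ((su2Rep (u ((0 : Site 3 1), (0 : Fin 3)))).trace.re) ^ 2)) U * Ω U) Ω with hc
  have hFphys : IsPhys (L := L) (flowLift 0 (fun u : GaugeConfig 3 1 SU2 => 4 - ((su2Rep (u ((0 : Site 3 1), (0 : Fin 3)))).trace.re) ^ 2)) := isPhys_adjLoop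
  obtain ⟨CF, hCF⟩ := hFphys.bounded
  have hCF0 : 0 ≤ CF := (abs_nonneg _).trans (hCF (fun _ : Edge 3 L => (1 : SU2)))
  obtain ⟨CΩ, hCΩ⟩ := hΩ.bounded
  have hCΩ0 : 0 ≤ CΩ := (abs_nonneg _).trans (hCΩ (fun _ : Edge 3 L => (1 : SU2)))
  -- per-site identities
  have hx : ∀ x : Site 3 L,
      ∫ U, deriv (fun t : ℝ => (flowLift 0 (fun u : GaugeConfig 3 1 SU2 => 4 - ((su2Rep (u ((0 : Site 3 1), (0 : Fin 3)))).trace.re) ^ 2)) (Function.update U (x, (0 : Fin 3)) (U (x, (0 : Fin 3)) * expPauli (t • ((EuclideanSpace.equiv (Fin 3) ℝ).symm fun i => (su2Rep (U ((x).shift 0, (1 : Fin 3)) * polyakovSite (((x).shift 0).shift 1) U ((0 : Site 3 1), (0 : Fin 3)) * (U ((x).shift 0, (1 : Fin 3)))⁻¹)).trace.re * (-(Complex.I / 2) * (pauli i * su2Rep (U ((x).shift 0, (1 : Fin 3)) * polyakovSite (((x).shift 0).shift 1) U ((0 : Site 3 1), (0 : Fin 3)) * (U ((x).shift 0, (1 :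 Fin 3)))⁻¹)).trace).re))))) 0 * (Ω U * Ω U) ∂configMeasure SU2 L =
        -2 * ∫ U, ((flowLift 0 (fun u : GaugeConfig 3 1 SU2 => 4 - ((su2Rep (u ((0 : Site 3 1), (0 : Fin 3)))).trace.re) ^ 2)) U - c) * Ω U * deriv (fun t : ℝ => Ω (Function.update U (x, (0 : Fin 3)) (U (x, (0 : Fin 3)) * expPauli (t • ((EuclideanSpace.equiv (Fin 3) ℝ).symm fun i => (su2Rep (U ((x).shift 0, (1 : Fin 3)) * polyakovSite (((x).shift 0).shift 1) U ((0 : Site 3 1), (0 : Fin 3)) * (U ((x).shift 0, (1 : Fin 3)))⁻¹)).trace.re * (-(Complex.I / 2) * (pauli i * su2Rep (U ((x).shift 0, (1 : Fin 3)) * polyakovSite (((x).shift 0).shift 1) U ((0 : Site 3 1), (0 : Fin 3)) * (U ((x).shift 0, (1 : Fin 3)))⁻¹)).trace).re))))) 0 ∂configMeasure SU2 L :=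
    fun x => integral_torelonDeriv_vacuum_sq β (x, (0 : Fin 3)) (hdir x) (hblind x) hΩ heig c
  -- integrability of the summands
  have hiF : ∀ x : Site 3 L, Integrable (fun U => deriv (fun t : ℝ => (flowLift 0 (fun u : GaugeConfig 3 1 SU2 => 4 - ((su2Rep (u ((0 : Site 3 1), (0 : Fin 3)))).trace.re) ^ 2)) (Function.update U (x, (0 : Fin 3)) (U (x, (0 : Fin 3)) * expPauli (t • ((EuclideanSpace.equiv (Fin 3) ℝ).symm fun i => (su2Rep (U ((x).shift 0, (1 : Fin 3)) * polyakovSite (((x).shift 0).shift 1) U ((0 : Site 3 1), (0 : Fin 3)) * (U ((x).shift 0, (1 : Fin 3)))⁻¹)).trace.re * (-(Complex.I / 2) * (pauli i * su2Rep (U ((x).shift 0, (1 : Fin 3)) * polyakovSite (((x).shift 0).shift 1) U ((0 : Site 3 1), (0 : Fin 3)) * (U ((x).shift 0, (1 : Fin 3)))⁻¹)).trace).re))))) 0 * (Ω U * Ω U)) (configMeasure SU2 L) := by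
    intro x
    obtain ⟨F', hF'c, ⟨CF', hCF'0, hCF', -⟩, hF'⟩ := lipschitz_torelonDev_flow (x, (0 : Fin 3)) (hdir x) (hblind x)
    have heq : (fun U => deriv (fun t : ℝ => (flowLift 0 (fun u : GaugeConfig 3 1 SU2 => 4 - ((su2Rep (u ((0 : Site 3 1), (0 : Fin 3)))).trace.re) ^ 2)) (Function.update U (x, (0 : Fin 3)) (U (x, (0 : Fin 3)) * expPauli (t • ((EuclideanSpace.equiv (Fin 3) ℝ).symm fun i => (su2Rep (U ((x).shift 0, (1 : Fin 3)) * polyakovSite (((x).shift 0).shift 1) U ((0 : Site 3 1), (0 : Fin 3)) * (U ((x).shift 0, (1 : Fin 3)))⁻¹)).trace.re * (-(Complex.I / 2) * (pauli i * su2Rep (U ((x).shift 0, (1 : Fin 3)) * polyakovSite (((x).shift 0).shift 1) U ((0 : Site 3 1), (0 : Fin 3)) * (U ((x).shift 0, (1 : Fin 3)))⁻¹)).trace).re))))) 0) = F' := funext fun U => (hF' U).deriv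
    refine integrable_mul_of_bdd (by rw [heq]; exact hF'c.measurable) (hΩ.measurable.mul hΩ.measurable)
      (Cf := CF') (fun U => by rw [(hF' U).deriv]; exact hCF' U)
      (fun U => by rw [abs_mul]; exact mul_le_mul (hCΩ U) (hCΩ U) (abs_nonneg _) hCΩ0)
  have hXΩc : Continuous fun U : GaugeConfig 3 L SU2 => ∑ x : Site 3 L, deriv (fun t : ℝ => Ω (Function.update U (x, (0 : Fin 3)) (U (x, (0 : Fin 3)) * expPauli (t • ((EuclideanSpace.equiv (Fin 3) ℝ).symm fun i => (su2Rep (U ((x).shift 0, (1 : Fin 3)) * polyakovSite (((x).shift 0).shift 1) U ((0 : Site 3 1), (0 : Fin 3)) * (U ((x).shift 0, (1 : Fin 3)))⁻¹)).trace.re * (-(Complex.I / 2) * (pauli i * su2Rep (U ((x).shift 0, (1 : Fin 3)) * polyakovSite (((x).shift 0).shift 1) U ((0 : Site 3 1), (0 : Fin 3)) * (U ((x).shift 0, (1 : Fin 3)))⁻¹)).trace).re))))) 0 :=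
    continuous_finsetSum _ fun x _ => continuous_deriv_vacuum_rightShift β (x, (0 : Fin 3)) (hdir x) hΩ heig
  obtain ⟨CX, hCX0, hCX⟩ := exists_abs_le_of_continuous hXΩc
  have hfm : Measurable fun U => ((flowLift 0 (fun u : GaugeConfig 3 1 SU2 => 4 - ((su2Rep (u ((0 : Site 3 1), (0 : Fin 3)))).trace.re) ^ 2)) U - c) * Ω U := (hFphys.measurable.sub measurable_const).mul hΩ.measurable
  have hfb : ∀ U, |((flowLift 0 (fun u : GaugeConfig 3 1 SU2 => 4 - ((su2Rep (u ((0 : Site 3 1), (0 : Fin 3)))).trace.re) ^ 2)) U - c) * Ω U| ≤ (CF + |c|) * CΩ :=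
    fun U => by rw [abs_mul]; exact mul_le_mul ((abs_sub _ _).trans (add_le_add (hCF U) le_rfl)) (hCΩ U) (abs_nonneg _) (add_nonneg hCF0 (abs_nonneg c))
  have hiG : ∀ x : Site 3 L, Integrable (fun U => ((flowLift 0 (fun u : GaugeConfig 3 1 SU2 => 4 - ((su2Rep (u ((0 : Site 3 1), (0 : Fin 3)))).trace.re) ^ 2)) U - c) * Ω U * deriv (fun t : ℝ => Ω (Function.update U (x, (0 : Fin 3)) (U (x, (0 : Fin 3)) * expPauli (t • ((EuclideanSpace.equiv (Fin 3) ℝ).symm fun i => (su2Rep (U ((x).shift 0, (1 : Fin 3)) * polyakovSite (((x).shift 0).shift 1) U ((0 : Site 3 1), (0 : Fin 3)) * (U ((x).shift 0, (1 : Fin 3)))⁻¹)).trace.re * (-(Complex.I / 2) * (pauli i * su2Rep (U ((x).shift 0, (1 : Fin 3)) * polyakovSite (((x).shift 0).shift 1) U ((0 : Site 3 1), (0 : Fin 3)) * (U ((x).shift 0, (1 : Fin 3)))⁻¹)).trace).re))))) 0) (configMeasure SU2 L) := by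
    intro x
    obtain ⟨Cd, -, hCd⟩ := bounded_deriv_vacuum_rightShift β (x, (0 : Fin 3)) (hdir x) hΩ heig
    exact integrable_mul_of_bdd hfm (measurable_deriv_vacuum_rightShift β (x, (0 : Fin 3)) (hdir x) hΩ heig) hfb hCd
  -- `⟨(XF)Ω, Ω⟩ = −2 ⟨(F−c)Ω, XΩ⟩`
  have hkey : l2 (fun U => (∑ x : Site 3 L, deriv (fun t : ℝ => (flowLift 0 (fun u : GaugeConfig 3 1 SU2 => 4 - ((su2Rep (u ((0 : Site 3 1), (0 : Fin 3)))).trace.re) ^ 2)) (Function.update U (x, (0 : Fin 3)) (U (x, (0 : Fin 3)) * expPauli (t • ((EuclideanSpace.equiv (Fin 3) ℝ).symm fun i => (su2Rep (U ((x).shift 0, (1 : Fin 3)) * polyakovSite (((x).shift 0).shift 1) U ((0 : Site 3 1), (0 : Fin 3)) * (U ((x).shift 0, (1 : Fin 3)))⁻¹)).trace.re * (-(Complex.I / 2) * (pauli i * su2Rep (U ((x).shift 0, (1 : Fin 3)) * polyakovSite (((x).shift 0).shift 1) U ((0 : Site 3 1), (0 : Fin 3)) * (U ((x).shift 0, (1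 : Fin 3)))⁻¹)).trace).re))))) 0) * Ω U) Ω =
      -2 * l2 (fun U => ((flowLift 0 (fun u : GaugeConfig 3 1 SU2 => 4 - ((su2Rep (u ((0 : Site 3 1), (0 : Fin 3)))).trace.re) ^ 2)) U - c) * Ω U) (fun U => ∑ x : Site 3 L, deriv (fun t : ℝ => Ω (Function.update U (x, (0 : Fin 3)) (U (x, (0 : Fin 3)) * expPauli (t • ((EuclideanSpace.equiv (Fin 3) ℝ).symm fun i => (su2Rep (U ((x).shift 0, (1 : Fin 3)) * polyakovSite (((x).shift 0).shift 1) U ((0 : Site 3 1), (0 : Fin 3)) * (U ((x).shift 0, (1 : Fin 3)))⁻¹)).trace.re * (-(Complex.I / 2) * (pauli i * su2Rep (U ((x).shift 0, (1 : Fin 3)) * polyakovSite (((x).shift 0).shift 1) U ((0 : Site 3 1), (0 : Fin 3)) * (U ((x).shift 0, (1 : Fin 3)))⁻¹)).trace).re))))) 0) := by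
    unfold l2
    rw [show (fun U => (∑ x : Site 3 L, deriv (fun t : ℝ => (flowLift 0 (fun u : GaugeConfig 3 1 SU2 => 4 - ((su2Rep (u ((0 : Site 3 1), (0 : Fin 3)))).trace.re) ^ 2)) (Function.update U (x, (0 : Fin 3)) (U (x, (0 : Fin 3)) * expPauli (t • ((EuclideanSpace.equiv (Fin 3) ℝ).symm fun i => (su2Rep (U ((x).shift 0, (1 : Fin 3)) * polyakovSite (((x).shift 0).shift 1) U ((0 : Site 3 1), (0 : Fin 3)) * (U ((x).shift 0, (1 : Fin 3)))⁻¹)).trace.re * (-(Complex.I / 2) * (pauli i * su2Rep (U ((x).shift 0, (1 : Fin 3)) * polyakovSite (((x).shift 0).shift 1) U ((0 : Site 3 1), (0 : Fin 3)) * (U ((x).shift 0, (1 : Fin 3)))⁻¹)).trace).re))))) 0) * Ω U * Ω U) =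
        fun U => ∑ x : Site 3 L, deriv (fun t : ℝ => (flowLift 0 (fun u : GaugeConfig 3 1 SU2 => 4 - ((su2Rep (u ((0 : Site 3 1), (0 : Fin 3)))).trace.re) ^ 2)) (Function.update U (x, (0 : Fin 3)) (U (x, (0 : Fin 3)) * expPauli (t • ((EuclideanSpace.equiv (Fin 3) ℝ).symm fun i => (su2Rep (U ((x).shift 0, (1 : Fin 3)) * polyakovSite (((x).shift 0).shift 1) U ((0 : Site 3 1), (0 : Fin 3)) * (U ((x).shift 0, (1 : Fin 3)))⁻¹)).trace.re * (-(Complex.I / 2) * (pauli i * su2Rep (U ((x).shift 0, (1 : Fin 3)) * polyakovSite (((x).shift 0).shift 1) U ((0 : Site 3 1), (0 : Fin 3)) * (U ((x).shift 0, (1 : Fin 3)))⁻¹)).trace).re))))) 0 * (Ω U * Ω U) from funext fun U => by rw [Finset.sum_mul, Finset.sum_mul]; simp only [mul_assoc],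
      integral_finsetSum _ fun x _ => hiF x]
    rw [show (fun U => ((flowLift 0 (fun u : GaugeConfig 3 1 SU2 => 4 - ((su2Rep (u ((0 : Site 3 1), (0 : Fin 3)))).trace.re) ^ 2)) U - c) * Ω U * ∑ x : Site 3 L, deriv (fun t : ℝ => Ω (Function.update U (x, (0 : Fin 3)) (U (x, (0 : Fin 3)) * expPauli (t • ((EuclideanSpace.equiv (Fin 3) ℝ).symm fun i => (su2Rep (U ((x).shift 0, (1 : Fin 3)) * polyakovSite (((x).shift 0).shift 1) U ((0 : Site 3 1), (0 : Fin 3)) * (U ((x).shift 0, (1 : Fin 3)))⁻¹)).trace.re * (-(Complex.I / 2) * (pauli i * su2Rep (U ((x).shift 0, (1 : Fin 3)) * polyakovSite (((x).shift 0).shift 1) U ((0 : Site 3 1), (0 : Fin 3)) * (U ((x).shift 0, (1 : Fin 3)))⁻¹)).trace).re))))) 0) =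
        fun U => ∑ x : Site 3 L, ((flowLift 0 (fun u : GaugeConfig 3 1 SU2 => 4 - ((su2Rep (u ((0 : Site 3 1), (0 : Fin 3)))).trace.re) ^ 2)) U - c) * Ω U * deriv (fun t : ℝ => Ω (Function.update U (x, (0 : Fin 3)) (U (x, (0 : Fin 3)) * expPauli (t • ((EuclideanSpace.equiv (Fin 3) ℝ).symm fun i => (su2Rep (U ((x).shift 0, (1 : Fin 3)) * polyakovSite (((x).shift 0).shift 1) U ((0 : Site 3 1), (0 : Fin 3)) * (U ((x).shift 0, (1 : Fin 3)))⁻¹)).trace.re * (-(Complex.I / 2) * (pauli i * su2Rep (U ((x).shift 0, (1 : Fin 3)) * polyakovSite (((x).shift 0).shift 1) U ((0 : Site 3 1), (0 : Fin 3)) * (U ((x).shift 0, (1 : Fin 3)))⁻¹)).trace).re))))) 0 from funext fun U => Finset.mul_sum _ _ _,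
      integral_finsetSum _ fun x _ => hiG x, Finset.mul_sum]
    exact Finset.sum_congr rfl fun x _ => hx x
  -- Cauchy–Schwarz and the variance identity
  have hCS := l2_sq_le_of_bdd hfm hXΩc.measurable hfb hCX
  have hvar : l2 (fun U => ((flowLift 0 (fun u : GaugeConfig 3 1 SU2 => 4 - ((su2Rep (u ((0 : Site 3 1), (0 : Fin 3)))).trace.re) ^ 2)) U - c) * Ω U) (fun U => ((flowLift 0 (fun u : GaugeConfig 3 1 SU2 => 4 - ((su2Rep (u ((0 : Site 3 1), (0 : Fin 3)))).trace.re) ^ 2)) U - c) * Ω U) =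
      l2 (fun U => (flowLift 0 (fun u : GaugeConfig 3 1 SU2 => 4 - ((su2Rep (u ((0 : Site 3 1), (0 : Fin 3)))).trace.re) ^ 2)) U * Ω U) (fun U => (flowLift 0 (fun u : GaugeConfig 3 1 SU2 => 4 - ((su2Rep (u ((0 : Site 3 1), (0 : Fin 3)))).trace.re) ^ 2)) U * Ω U) - c ^ 2 := by
    have hFΩm : Measurable fun U => (flowLift 0 (fun u : GaugeConfig 3 1 SU2 => 4 - ((su2Rep (u ((0 : Site 3 1), (0 : Fin 3)))).trace.re) ^ 2)) U * Ω U := hFphys.measurable.mul hΩ.measurable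
    have hFΩb : ∀ U, |(flowLift 0 (fun u : GaugeConfig 3 1 SU2 => 4 - ((su2Rep (u ((0 : Site 3 1), (0 : Fin 3)))).trace.re) ^ 2)) U * Ω U| ≤ CF * CΩ := fun U => by
      rw [abs_mul]; exact mul_le_mul (hCF U) (hCΩ U) (abs_nonneg _) hCF0
    have i1 := integrable_mul_of_bdd hFΩm hFΩm hFΩb hFΩb
    have i2 : Integrable (fun U => 2 * c * ((flowLift 0 (fun u : GaugeConfig 3 1 SU2 => 4 - ((su2Rep (u ((0 : Site 3 1), (0 : Fin 3)))).trace.re) ^ 2)) U * Ω U * Ω U)) (configMeasure SU2 L) :=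
      (integrable_mul_of_bdd hFΩm hΩ.measurable hFΩb hCΩ).const_mul _
    have i3 : Integrable (fun U => c ^ 2 * (Ω U * Ω U)) (configMeasure SU2 L) :=
      (integrable_mul_of_bdd hΩ.measurable hΩ.measurable hCΩ hCΩ).const_mul _
    have j1 : Integrable (fun U => (flowLift 0 (fun u : GaugeConfig 3 1 SU2 => 4 - ((su2Rep (u ((0 : Site 3 1), (0 : Fin 3)))).trace.re) ^ 2)) U * Ω U * ((flowLift 0 (fun u : GaugeConfig 3 1 SU2 => 4 - ((su2Rep (u ((0 : Site 3 1), (0 : Fin 3)))).trace.re) ^ 2)) U * Ω U) - 2 * c * ((flowLift 0 (fun u : GaugeConfig 3 1 SU2 => 4 - ((su2Rep (u ((0 : Site 3 1), (0 : Fin 3)))).trace.re) ^ 2)) U * Ω U * Ω U)) (configMeasure SU2 L) := i1.sub i2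
    have hn' : ∫ U, Ω U * Ω U ∂configMeasure SU2 L = 1 := hn
    have hc' : ∫ U, (flowLift 0 (fun u : GaugeConfig 3 1 SU2 => 4 - ((su2Rep (u ((0 : Site 3 1), (0 : Fin 3)))).trace.re) ^ 2)) U * Ω U * Ω U ∂configMeasure SU2 L = c := rfl
    unfold l2
    have hpt : (fun U => ((flowLift 0 (fun u : GaugeConfig 3 1 SU2 => 4 - ((su2Rep (u ((0 : Site 3 1), (0 : Fin 3)))).trace.re) ^ 2)) U - c) * Ω U * (((flowLift 0 (fun u : GaugeConfig 3 1 SU2 => 4 - ((su2Rep (u ((0 : Site 3 1), (0 : Fin 3)))).trace.re) ^ 2)) U - c) * Ω U)) =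
        fun U => ((flowLift 0 (fun u : GaugeConfig 3 1 SU2 => 4 - ((su2Rep (u ((0 : Site 3 1), (0 : Fin 3)))).trace.re) ^ 2)) U * Ω U * ((flowLift 0 (fun u : GaugeConfig 3 1 SU2 => 4 - ((su2Rep (u ((0 : Site 3 1), (0 : Fin 3)))).trace.re) ^ 2)) U * Ω U) - 2 * c * ((flowLift 0 (fun u : GaugeConfig 3 1 SU2 => 4 - ((su2Rep (u ((0 : Site 3 1), (0 : Fin 3)))).trace.re) ^ 2)) U * Ω U * Ω U)) + c ^ 2 * (Ω U * Ω U) := by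
      funext U; ring
    rw [hpt, integral_add j1 i3, integral_sub i1 i2, integral_const_mul, integral_const_mul, hn', hc']
    ring
  rw [hkey, hvar.symm]
  nlinarith [hCS]

end Summit.QuantumFields.YangMills.Theorems.TransportFieldFano

end
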